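import Summits.AtomisticToContinuum.HydrodynamicLimit.Theorems.CollisionIsometryCLTDiffuseBackwardInfluenceOnePathBound
import Literature.Analysis.FluidPDE.HardSphereFlowMeasurable
import Literature.Analysis.FluidPDE.HardSphereRegularGeometry
import HarnessLib
import Summits.AtomisticToContinuum.HydrodynamicLimit.Theorems.CollisionIsometryCLTDiffuseBackwardInfluencePairDefs


namespace Summit.AtomisticToContinuum.HydrodynamicLimit.Theorems.DiffuseBackwardInfluenceShare

open scoped BigOperators Topology ENNReal InnerProductSpace Classical
open Filter Set MeasureTheory
open Literature.Analysis.FluidPDE (Config HardSphereFlow collidePair)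
open Literature.MathematicalPhysics.KineticTheory (localGibbsLaw hsDiameter)
open Summit.AtomisticToContinuum.HydrodynamicLimit.Theorems.DiffuseBackwardInfluenceNeg

noncomputable section

/-!
# Measurability of the cross-slot re-merge fraction (registered stub `stub_crossRemMeasurable`, skeleton v7)
(`DiffuseBackwardInfluence`, line `share-nondegeneracy-one-flight`, stmt-AtomisticToContinuum-12950; `--supports`)

For `σ < 1/2` the reduced diameter `ε = σ (N+1)^{-1/3}` is `< 1/2`, so the torus geometry is hard-sphere regular
(`Torus.isHardSphereRegular_geometry`) and measurable (`Torus.isMeasurable_geometry`), and the Alexander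
construction is measurable (`Literature.Analysis.FluidPDE.HardSphereFlowMeasurable`). From there:
(1) `y ↦ pre σ N y k` is measurable (`measurable_pre`); (2) every function of `y` that factors through the SET of
reflected pairs `pairsAt σ N y k` (finitely many values, measurable level sets) and measurable data is measurable
(`measurable_pairsAt_param`, `measurable_dite_pairsAt`) — this disposes of every `h.some`; (3) `step`,
`transferN`, `blockCol`, `blockMass`, `blockShare`, `normalAt`, `unitNormal`, `shareFrac`, `hopKernel` are
measurable in `y` (compositions); (4) `colls`, hence `slotStart`, is measurable and `ℕ`-valued, and a function of a
measurable `ℕ`-valued parameter is handled by splitting over its countably many values (`measurable_natParam`,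
`measurable_sum_range`); (5) `apartFrom` (induction on the step), `crossRemAt`, `crossRemFr` are finite sums.
-/

section Measurability

open Literature.Analysis.FluidPDE (Torus.geometry Torus.isMeasurable_geometry Torus.isHardSphereRegular_geometry)
open Literature.Analysis.FluidPDE.Geometry.IsMeasurable (measurable_pos measurable_freeFlight₂
  measurable_collidePair measurable_sepVec_config)
open Literature.Analysis.FluidPDE.Alexander (measurable_stateAfter measurable_freeExitTime
  measurableSet_mem_incomingPairs measurable_collisionCount)
open Literature.MathematicalPhysics.KineticTheory (hsDiameter_le)

variable {σ : ℝ} {N : ℕ}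

/-! ### Generic devices -/

/-- For `σ < 1/2` the reduced diameter `σ (N+1)^{-1/3}` is `< 1/2`, so the torus geometry is hard-sphere regular
at it (`Torus.isHardSphereRegular_geometry`). -/
theorem regular_of_lt_half (hσ : σ < 1 / 2) (N : ℕ) :
    (Torus.geometry (Fin 3)).IsHardSphereRegular (hsDiameter σ N) := by
  refine Torus.isHardSphereRegular_geometry ?_
  rcases le_or_gt 0 σ with hσ0 | hσ0
  · exact (hsDiameter_le hσ0 N).trans_lt (by rw [← one_div]; exact hσ)
  · have h : hsDiameter σ N < 0 :=
      mul_neg_of_neg_of_pos hσ0 (Real.rpow_pos_of_pos (by positivity) _)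
    exact h.trans (by norm_num)

/-- A function of a measurable `ℕ`-valued parameter and of the point is measurable as soon as each section is
(split over the countably many values of the parameter). -/
theorem measurable_natParam {α β : Type*} [MeasurableSpace α] [MeasurableSpace β] {f : ℕ → α → β}
    (hf : ∀ n, Measurable (f n)) {n : α → ℕ} (hn : Measurable n) : Measurable fun a => f (n a) a :=
  (measurable_from_prod_countable_right (f := fun p : ℕ × α => f p.1 p.2) hf).comp
    (hn.prodMk measurable_id)

/-- The (truncated) difference of two measurable `ℕ`-valued functions is measurable. -/
theorem measurable_natSub {α : Type*} [MeasurableSpace α] {a b : α → ℕ} (ha : Measurable a)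
    (hb : Measurable b) : Measurable fun x => a x - b x :=
  (measurable_of_countable fun p : ℕ × ℕ => p.1 - p.2).comp (ha.prodMk hb)

/-- A finite sum of measurable real functions over `Finset.range` of a measurable length is measurable. -/
theorem measurable_sum_range {α : Type*} [MeasurableSpace α] {f : ℕ → α → ℝ} (hf : ∀ t, Measurable (f t))
    {n : α → ℕ} (hn : Measurable n) : Measurable fun a => ∑ t ∈ Finset.range (n a), f t a :=
  measurable_natParam (f := fun m a => ∑ t ∈ Finset.range m, f t a)
    (fun _ => Finset.measurable_sum _ fun t _ => hf t) hn

/-- The generic exchange kernel `kstep p q f i' i` is measurable in the fractions `f`. -/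
theorem measurable_kstep {α ι : Type*} [MeasurableSpace α] [DecidableEq ι] [Fintype ι] (p q i' i : ι)
    {f : α → ι → ℝ} (hf : ∀ j, Measurable fun a => f a j) :
    Measurable fun a => PairPath.kstep p q (f a) i' i := by
  unfold PairPath.kstep
  by_cases h1 : i' = p
  · simp only [if_pos h1]
    by_cases h2 : i = p
    · simp only [if_pos h2]
      exact measurable_const.sub (hf p)
    · simp only [if_neg h2]
      by_cases h3 : i = q
      · simp only [if_pos h3]
        exact hf p
      · simp only [if_neg h3]
        exact measurable_const
  · simp only [if_neg h1]
    by_cases h2 : i' = q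
    · simp only [if_pos h2]
      by_cases h3 : i = q
      · simp only [if_pos h3]
        exact measurable_const.sub (hf q)
      · simp only [if_neg h3]
        by_cases h4 : i = p
        · simp only [if_pos h4]
          exact hf q
        · simp only [if_neg h4]
          exact measurable_const
    · simp only [if_neg h2]
      exact measurable_const

/-! ### The Alexander data of a fold step -/

variable (hG : (Torus.geometry (Fin 3)).IsHardSphereRegular (hsDiameter σ N))
include hG

/-- `y ↦ pre σ N y k` is measurable (Alexander construction: `measurable_stateAfter`, `measurable_freeExitTime`,
`measurable_freeFlight₂`). -/
theorem measurable_pre (k : ℕ) : Measurable fun y : Cfg N => pre σ N y k := by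
  -- adapted from `ContactSourceDuhamel.TimeLocal.Reduction.reduction_measurable_pre` (same body, other namespace)
  have hst := measurable_stateAfter (N := N + 1) hG Torus.isMeasurable_geometry k
  unfold pre
  exact ((measurable_freeFlight₂ Torus.isMeasurable_geometry).comp
    ((((measurable_freeExitTime hG Torus.isMeasurable_geometry).comp hst).ennreal_toReal).prodMk hst) :)

/-- Membership of a fixed pair in `pairsAt σ N y k` is a measurable condition on `y`. -/
theorem measurableSet_mem_pairsAt (k : ℕ) (p : Fin (N + 1) × Fin (N + 1)) :
    MeasurableSet {y : Cfg N | p ∈ pairsAt σ N y k} :=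
  (measurableSet_mem_incomingPairs Torus.isMeasurable_geometry p).preimage (measurable_pre hG k)

/-- **Functions of the set of reflected pairs are measurable.** If each section `F P` is measurable, so is
`y ↦ F (pairsAt σ N y k) y`: the set-valued map `y ↦ pairsAt σ N y k` takes finitely many values on measurable
level sets. This disposes of every `h.some`, which depends on `y` only through the set. -/
theorem measurable_pairsAt_param {β : Type*} [MeasurableSpace β] (k : ℕ)
    {F : Set (Fin (N + 1) × Fin (N + 1)) → Cfg N → β} (hF : ∀ P, Measurable (F P)) :
    Measurable fun y => F (pairsAt σ N y k) y := by
  -- adapted from `Literature.Analysis.FluidPDE.Alexander.measurable_stepMap_incomingPairs`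
  letI : MeasurableSpace (Set (Fin (N + 1) × Fin (N + 1))) := ⊤
  haveI : MeasurableSingletonClass (Set (Fin (N + 1) × Fin (N + 1))) := ⟨fun _ => trivial⟩
  have hS : Measurable fun y : Cfg N => pairsAt σ N y k := by
    refine measurable_to_countable' fun P => ?_
    have hset : (fun y : Cfg N => pairsAt σ N y k) ⁻¹' {P} =
        ⋂ p : Fin (N + 1) × Fin (N + 1), {y | p ∈ pairsAt σ N y k ↔ p ∈ P} := by
      ext y
      simp only [mem_preimage, mem_singleton_iff, mem_iInter, mem_setOf_eq, Set.ext_iff]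
    rw [hset]
    refine MeasurableSet.iInter fun p => measurableSet_setOf.2 ?_
    exact (measurableSet_setOf.1 (measurableSet_mem_pairsAt hG k p)).iff measurable_const
  exact (measurable_from_prod_countable_right
    (f := fun p : Set (Fin (N + 1) × Fin (N + 1)) × Cfg N => F p.1 p.2) hF).comp (hS.prodMk measurable_id)

/-- The `dite` on `(pairsAt σ N y k).Nonempty` with measurable branches (the positive branch read at the chosen
pair `h.some`) is measurable in `y`. -/
theorem measurable_dite_pairsAt {β : Type*} [MeasurableSpace β] (k : ℕ)
    {Φ : Fin (N + 1) → Fin (N + 1) → Cfg N → β} (hΦ : ∀ p q, Measurable (Φ p q))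
    {g : Cfg N → β} (hg : Measurable g) :
    Measurable fun y => @dite β (pairsAt σ N y k).Nonempty (Classical.propDecidable _)
      (fun h => Φ h.some.1 h.some.2 y) (fun _ => g y) := by
  refine measurable_pairsAt_param hG k (F := fun P y => @dite β P.Nonempty (Classical.propDecidable _)
    (fun h => Φ h.some.1 h.some.2 y) (fun _ => g y)) fun P => ?_
  by_cases h : P.Nonempty
  · simp only [dif_pos h]
    exact hΦ _ _
  · simp only [dif_neg h]
    exact hg

/-! ### The fold, the blocks, the normal, the hop kernel -/

/-- `y ↦ step σ N y (W y) k` is measurable for a measurable velocity field `W`. -/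
theorem measurable_step (k : ℕ) {W : Cfg N → Fin (N + 1) → V3} (hW : Measurable W) :
    Measurable fun y => step σ N y (W y) k := by
  have hcfg : Measurable fun y : Cfg N => (fun j => ((pre σ N y k j).1, W y j) : Cfg N) :=
    measurable_pi_lambda _ fun j =>
      ((measurable_pos j).comp (measurable_pre hG k)).prodMk ((measurable_pi_apply j).comp hW)
  unfold step
  exact measurable_dite_pairsAt hG k
    (Φ := fun p q y => fun i =>
      (collidePair (Torus.geometry (Fin 3)) p q (fun j => ((pre σ N y k j).1, W y j)) i).2)
    (fun p q => measurable_pi_lambda _ fun i =>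
      ((measurable_pi_apply i).comp
        ((measurable_collidePair Torus.isMeasurable_geometry p q).comp hcfg)).snd) hW

/-- `y ↦ transferN σ N y n W` is measurable (induction on the number of fold steps). -/
theorem measurable_transferN (W : Fin (N + 1) → V3) : ∀ n : ℕ, Measurable fun y => transferN σ N y n W
  | 0 => by simpa only [transferN_zero] using measurable_const
  | n + 1 => by
    simp only [transferN_succ]
    exact measurable_step hG n (measurable_transferN W n)

/-- `y ↦ blockCol σ N y n i k a` is measurable. -/
theorem measurable_blockCol (n : ℕ) (i k : Fin (N + 1)) (a : Fin 3) :
    Measurable fun y => blockCol σ N y n i k a :=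
  (measurable_pi_apply i).comp (measurable_transferN hG _ n)

/-- `y ↦ blockMass σ N y n i k` is measurable. -/
theorem measurable_blockMass (n : ℕ) (i k : Fin (N + 1)) : Measurable fun y => blockMass σ N y n i k :=
  Finset.measurable_sum _ fun a _ => (measurable_blockCol hG n i k a).norm.pow_const 2

/-- `y ↦ blockShare σ N y n i k (ω y)` is measurable for a measurable direction field `ω`. -/
theorem measurable_blockShare (n : ℕ) (i k : Fin (N + 1)) {ω : Cfg N → V3} (hω : Measurable ω) :
    Measurable fun y => blockShare σ N y n i k (ω y) :=
  Finset.measurable_sum _ fun a _ => (hω.inner (measurable_blockCol hG n i k a)).pow_const 2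

/-- `y ↦ normalAt σ N y k` is measurable. -/
theorem measurable_normalAt (k : ℕ) : Measurable fun y => normalAt σ N y k := by
  unfold normalAt
  exact measurable_dite_pairsAt hG k
    (Φ := fun p q y => (Torus.geometry (Fin 3)).sepVec (pre σ N y k p).1 (pre σ N y k q).1)
    (fun p q => (measurable_sepVec_config Torus.isMeasurable_geometry p q).comp (measurable_pre hG k))
    measurable_const

/-- `y ↦ unitNormal σ N y k` is measurable. -/
theorem measurable_unitNormal (k : ℕ) : Measurable fun y => unitNormal σ N y k :=
  (measurable_normalAt hG k).norm.inv.smul (measurable_normalAt hG k)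

/-- `y ↦ shareFrac σ N y n i k (unitNormal σ N y n)` is measurable. -/
theorem measurable_shareFrac (n : ℕ) (i k : Fin (N + 1)) :
    Measurable fun y => shareFrac σ N y n i k (unitNormal σ N y n) :=
  (measurable_blockShare hG n i k (measurable_unitNormal hG n)).div (measurable_blockMass hG n i k)

/-- `y ↦ hopKernel σ N y src n i' i` is measurable (it is the generic kernel `kstep` of the reflected pair with
the measurable fractions `shareFrac`, or the identity). -/
theorem measurable_hopKernel (src : Fin (N + 1)) (n : ℕ) (i' i : Fin (N + 1)) :
    Measurable fun y => hopKernel σ N y src n i' i := by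
  have heq : (fun y => hopKernel σ N y src n i' i) = fun y =>
      @dite ℝ (pairsAt σ N y n).Nonempty (Classical.propDecidable _)
        (fun h => PairPath.kstep h.some.1 h.some.2
          (fun j => shareFrac σ N y n j src (unitNormal σ N y n)) i' i)
        (fun _ => if i = i' then 1 else 0) := rfl
  rw [heq]
  exact measurable_dite_pairsAt hG n
    (Φ := fun p q y => PairPath.kstep p q (fun j => shareFrac σ N y n j src (unitNormal σ N y n)) i' i)
    (fun p q => measurable_kstep p q i' i fun j => measurable_shareFrac hG n j src) measurable_const

/-! ### The slot grid and the two-tracer functionals -/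

/-- `y ↦ colls σ N y t` is measurable (`Alexander.measurable_collisionCount`). -/
theorem measurable_colls (t : ℝ) : Measurable fun y : Cfg N => colls σ N y t :=
  measurable_collisionCount hG Torus.isMeasurable_geometry t

/-- `y ↦ slotStart σ N y Δ S r` is measurable. -/
theorem measurable_slotStart (Δ : ℝ) (S r : ℕ) : Measurable fun y : Cfg N => slotStart σ N y Δ S r :=
  measurable_colls hG _

/-- The hop kernel read at the `t`-th step of slot `r` is measurable in `y`. -/
theorem measurable_hopKernel_slot (src : Fin (N + 1)) (Δ : ℝ) (S r t : ℕ) (i' i : Fin (N + 1)) :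
    Measurable fun y => hopKernel σ N y src (slotStart σ N y Δ S r + t) i' i :=
  measurable_natParam (f := fun n y => hopKernel σ N y src n i' i)
    (fun n => measurable_hopKernel hG src n i' i)
    ((measurable_from_nat (f := fun m : ℕ => m + t)).comp (measurable_slotStart hG Δ S r))

/-- `y ↦ apartFrom σ N y src Δ S r t i j` is measurable (induction on `t`). -/
theorem measurable_apartFrom (src : Fin (N + 1)) (Δ : ℝ) (S r : ℕ) :
    ∀ (t : ℕ) (i j : Fin (N + 1)), Measurable fun y => apartFrom σ N y src Δ S r t i j
  | 0, i, j => by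
    simp only [apartFrom]
    have hm : ∀ l : Fin (N + 1), Measurable fun y => blockMass σ N y (slotStart σ N y Δ S r) l src :=
      fun l => measurable_natParam (f := fun n y => blockMass σ N y n l src)
        (fun n => measurable_blockMass hG n l src) (measurable_slotStart hG Δ S r)
    by_cases hij : i = j
    · simp only [if_pos hij]
      exact measurable_const
    · simp only [if_neg hij]
      exact ((hm i).div_const 3).mul ((hm j).div_const 3)
  | t + 1, i, j => by
    simp only [apartFrom]
    by_cases hij : i = j
    · simp only [if_pos hij]
      exact measurable_const
    · simp only [if_neg hij]
      refine Finset.measurable_sum _ fun i' _ => Finset.measurable_sum _ fun j' _ => ?_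
      exact (measurable_apartFrom src Δ S r t i' j').mul
        ((measurable_hopKernel_slot hG src Δ S r t i' i).mul (measurable_hopKernel_slot hG src Δ S r t j' j))

/-- `y ↦ crossRemAt σ N y src Δ S r t` is measurable. -/
theorem measurable_crossRemAt (src : Fin (N + 1)) (Δ : ℝ) (S r t : ℕ) :
    Measurable fun y => crossRemAt σ N y src Δ S r t := by
  unfold crossRemAt
  refine Finset.measurable_sum _ fun i _ => Finset.measurable_sum _ fun i' _ =>
    Finset.measurable_sum _ fun j' _ => ?_
  exact (measurable_apartFrom hG src Δ S r t i' j').mul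
    ((measurable_hopKernel_slot hG src Δ S r t i' i).mul (measurable_hopKernel_slot hG src Δ S r t j' i))

/-- `y ↦ crossRemFr σ N y Δ S` is measurable. -/
theorem measurable_crossRemFr (Δ : ℝ) (S : ℕ) : Measurable fun y => crossRemFr σ N y Δ S := by
  unfold crossRemFr
  refine Measurable.const_mul (Finset.measurable_sum _ fun src _ => Finset.measurable_sum _ fun r _ => ?_) _
  exact measurable_sum_range (fun t => measurable_crossRemAt hG src Δ S r t)
    (measurable_natSub (measurable_slotStart hG Δ S (r + 1)) (measurable_slotStart hG Δ S r))

end Measurability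

/-- **MEASURABILITY OF THE CROSS-SLOT RE-MERGE FRACTION** (registered stub `stub_crossRemMeasurable` of skeleton
v7): for `σ < 1/2` (so that the reduced diameter is `< 1/2` and the torus geometry is hard-sphere regular),
`y ↦ crossRemFr σ N y Δ S` is measurable for every `N, Δ, S`. [folklore] -/
theorem stub_crossRemMeasurable : ∀ σ : ℝ, σ < 1 / 2 → CrossRemMeasurable σ :=
  fun _σ hσ N Δ S => measurable_crossRemFr (regular_of_lt_half hσ N) Δ S

end

end Summit.AtomisticToContinuum.HydrodynamicLimit.Theorems.DiffuseBackwardInfluenceShare
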